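import Summits.KontsevichZagierPeriods.KontsevichZagierPeriods.Theorems.LiftingCriteriaDilationTransferHomogScale
import Literature.NumberTheory.Transcendental.KZTorusLogRep
import Summits.KontsevichZagierPeriods.KontsevichZagierPeriods.Theorems.UnfoldedStokesHyperellipticRiemannRelationStubEngine

/-!
# A closed-loop logarithmic derivative on the triangle band is a relation (crux `DilationTransfer`, stmt-KontsevichZagierPeriods-3572)

Support file for crux `DilationTransfer`
(`Summit.KontsevichZagierPeriods.KontsevichZagierPeriods.Theses.LiftingCriteria.DilationTransfer`,
route `LiftingCriteria`, line `birth`, reshape 4), homogeneous layer on the square. After the pyramid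
reduction (`square_pyramid`) the fibre relation of a homogeneous dilation relation lives on the
triangle band `P = {(s,t) | 0 ≤ t ≤ s ≤ 1}`; its Hermite reduction over `ℚ(s)` has an exact part
(treated by `triangle_newtonLeibniz`, rung `dilationTransfer_homog_dim_two_exactSym`) and a
LOGARITHMIC part `Σ cₖ(s) ∂ₜuₖ/uₖ`, which function-field Baker forces to be FORMALLY trivial. The
rank-zero formal triviality is a CLOSED LOOP: `Q` Nash and positive near `P` with
`Q(s,0) = Q(s,s) = 1`. This file proves that such a term is a relation, transcendence-free, by
UNFOLDING in an idle coordinate `w` (the mechanism of route UnfoldedStokes, here with a parameter):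

* `triangle_closedLoop_dlog_mem_relations` — for `c` Nash in `s` and a closed loop `Q`,
  `[P, c(s)·∂ₜQ/Q] ∈ KZ.relations`. With `Q_w = (1 − w) + wQ > 0` on `P × [0,1]`,
  `A = c·w·∂ₜQ/Q_w` and `B = c·(Q − 1)/Q_w` satisfy `∂_wA = ∂ₜB = c·∂ₜQ/Q_w²` (`=: D`); Newton–Leibniz
  in `w` gives `[P × [0,1], D] ≡ [P, A|_{w=1} − A|_{w=0}] = [P, c∂ₜQ/Q]`, and — after the coordinate
  swap `t ↔ w` (`KZ.of_sub_of_reindex_mem_relations`) — Newton–Leibniz in `t` over the base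
  `[0,1]² ∋ (s,w)` with bounds `0 ≤ t ≤ s` gives `[P × [0,1], D] ≡ [[0,1]², B|_{t=s} − B|_{t=0}] = 0`
  because the loop is closed. All data are Nash; no primitive leaves the semialgebraic class.

## References
* M. Kontsevich, D. Zagier, *Periods* (2001), §1.2 (rules (2), (3)).
* J. Ayoub, *Une version relative de la conjecture des périodes de Kontsevich–Zagier*, Ann. of
  Math. 181 (2015), Rem. 1.5 (unfolding change of variables by Stokes in one more variable).
-/

noncomputable section

open scoped BigOperators Topology
open MeasureTheory Set Filter
open Literature.NumberTheory.Transcendental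
open Literature.ModelTheory.ExponentialFields (IsSemialgebraic)
open Literature.NumberTheory.Transcendental.KZ (init_fin_three)
open Summit.KontsevichZagierPeriods.UnfoldedStokes.HyperellipticRiemannRelationLine.Engine (snoc_eq)

namespace Summit.KontsevichZagierPeriods.LiftingCriteria.DilationTransfer

/-! ### Small toolkit on `ℝ²`, `ℝ³` -/

/-- The path `t ↦ (a, t)` is the coordinate update of any of its points. [folklore] -/
theorem vec_two_eq_update (a t₀ t : ℝ) : (![a, t] : Fin 2 → ℝ) = Function.update (![a, t₀]) 1 t := by
  ext i
  fin_cases i <;> simp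

/-- The path `t ↦ (a, t)` has velocity `e₁`. [folklore] -/
theorem hasDerivAt_vec_two (a t : ℝ) :
    HasDerivAt (fun t : ℝ => (![a, t] : Fin 2 → ℝ)) (Pi.single 1 1) t := by
  have e : (fun t : ℝ => (![a, t] : Fin 2 → ℝ)) = Function.update (![a, t]) 1 := by
    funext t'; exact vec_two_eq_update a t t'
  rw [e]
  exact hasDerivAt_update _ 1 t

/-! ### The closed-loop lemma -/

/-- **A closed-loop logarithmic derivative on the triangle band is a relation.** Let
`P = {y ∈ [0,1]² | y₁ ≤ y₀}`, `c` Nash near `[0,1]` (a function of `s = y₀` alone) and `Q` Nash on an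
open `W ⊇ P`, positive on `P`, with `Q(s,0) = Q(s,s) = 1` for `s ∈ [0,1]` (a CLOSED LOOP along every
fibre). Then every representation on `P` with integrand `c(s)·∂ₜQ/Q` lies in `KZ.relations`:
unfold in an idle coordinate `w ∈ [0,1]` with `Q_w = 1 − w + wQ`, `A = c w ∂ₜQ/Q_w`, `B = c(Q−1)/Q_w`,
`∂_wA = ∂ₜB`; Newton–Leibniz in `w` recovers the integrand, Newton–Leibniz in `t` (after the swap
`t ↔ w`) gives `0` because the loop is closed. [cite: KontsevichZagier2001, §1.2 rules (2), (3)]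
[cite: Ayoub2015, Rem. 1.5] -/
theorem triangle_closedLoop_dlog_mem_relations {c : ℝ → ℝ} {W : Set (Fin 2 → ℝ)} {Q : (Fin 2 → ℝ) → ℝ}
    (hca : ∀ s ∈ Set.Icc (0:ℝ) 1, AnalyticAt ℝ c s)
    (hcs : IsSemialgebraicFunOn ℚ (KZ.cube 1) (fun x : Fin 1 → ℝ => c (x 0)))
    (hWo : IsOpen W) (hPW : {y : Fin 2 → ℝ | y ∈ KZ.cube 2 ∧ y 1 ≤ y 0} ⊆ W)
    (hQs : IsSemialgebraicFunOn ℚ W Q) (hQa : AnalyticOnNhd ℝ Q W)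
    (hQpos : ∀ y ∈ {y : Fin 2 → ℝ | y ∈ KZ.cube 2 ∧ y 1 ≤ y 0}, 0 < Q y)
    (hQ0 : ∀ s ∈ Set.Icc (0:ℝ) 1, Q ![s, 0] = 1) (hQ1 : ∀ s ∈ Set.Icc (0:ℝ) 1, Q ![s, s] = 1)
    (T : KZ.IntegralRep 2) (hTd : T.domain = {y : Fin 2 → ℝ | y ∈ KZ.cube 2 ∧ y 1 ≤ y 0})
    (hTi : ∀ y ∈ {y : Fin 2 → ℝ | y ∈ KZ.cube 2 ∧ y 1 ≤ y 0},
      T.integrand y = c (y 0) * fderiv ℝ Q y (Pi.single 1 1) / Q y) :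
    KZ.of T ∈ KZ.relations := by
  set P : Set (Fin 2 → ℝ) := {y : Fin 2 → ℝ | y ∈ KZ.cube 2 ∧ y 1 ≤ y 0} with hP
  have hPs : IsSemialgebraic ℚ P := isSemialgebraic_lowerTriangle
  have hsw : (Equiv.swap (1 : Fin 3) 2) 0 = 0 := by decide
  -- the `t`-derivative of `Q`, Nash on `W`
  obtain ⟨Qt, hQt⟩ : ∃ Qt : (Fin 2 → ℝ) → ℝ, ∀ y, Qt y = fderiv ℝ Q y (Pi.single 1 1) := ⟨_, fun _ => rfl⟩
  have hQta : ∀ y ∈ W, AnalyticAt ℝ Qt y := fun y hy => by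
    rw [show Qt = _ from funext hQt]; exact analyticAt_fderiv_apply (hQa y hy) _
  have hQts : IsSemialgebraicFunOn ℚ W Qt := by
    rw [show Qt = _ from funext hQt]
    exact IsSemialgebraicFunOn.fderiv_apply_single hWo hQs (fun y hy => (hQa y hy).differentiableAt) 1
  have hQder : ∀ a t, (![a, t] : Fin 2 → ℝ) ∈ W →
      HasDerivAt (fun t : ℝ => Q ![a, t]) (Qt ![a, t]) t := by
    intro a t hmem
    have hdf : HasFDerivAt Q (fderiv ℝ Q ![a, t]) ![a, t] := (hQa _ hmem).differentiableAt.hasFDerivAt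
    have h := hdf.comp_hasDerivAt t (hasDerivAt_vec_two a t)
    rw [hQt]
    exact h
  -- membership bookkeeping
  have hPmem : ∀ {a t : ℝ}, 0 ≤ t → t ≤ a → a ≤ 1 → (![a, t] : Fin 2 → ℝ) ∈ P := by
    intro a t ht0 hta ha1
    refine ⟨fun i => ?_, by simpa using hta⟩
    fin_cases i
    · simpa using ⟨ht0.trans hta, ha1⟩
    · simpa using ⟨ht0, hta.trans ha1⟩
  have hvec2 : ∀ y : Fin 2 → ℝ, y = ![y 0, y 1] := fun y => by ext i; fin_cases i <;> rfl
  -- the unfolded denominator `Q_w = 1 − w + wQ` is positive for `w ∈ [0,1]` over `P`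
  have hden : ∀ {y}, y ∈ P → ∀ {w : ℝ}, 0 ≤ w → w ≤ 1 → 0 < 1 - w + w * Q y := by
    intro y hy w hw0 hw1
    have hq := hQpos y hy
    rcases eq_or_lt_of_le hw0 with h | h
    · rw [← h]; norm_num
    · nlinarith
  -- (1) the unfolded representation on `E = P × [0,1]` with integrand `D = c ∂ₜQ / Q_w²`
  set E : Set (Fin 3 → ℝ) := {z | (Fin.init z : Fin 2 → ℝ) ∈ T.domain ∧
      (0:ℝ) ≤ z (Fin.last 2) ∧ z (Fin.last 2) ≤ 1} with hE
  have hEmem : ∀ {z : Fin 3 → ℝ}, z ∈ E ↔ (![z 0, z 1] : Fin 2 → ℝ) ∈ P ∧ 0 ≤ z 2 ∧ z 2 ≤ 1 := by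
    intro z
    rw [hE, mem_setOf_eq, hTd, init_fin_three]
    rfl
  have hEs : IsSemialgebraic ℚ E := by
    have h1 : IsSemialgebraic ℚ {z : Fin 3 → ℝ | (Fin.init z : Fin 2 → ℝ) ∈ T.domain} :=
      (hTd ▸ hPs).setOf_init_mem
    have h2 : IsSemialgebraic ℚ {z : Fin 3 → ℝ | (0:ℝ) ≤ z (Fin.last 2)} := by
      simpa using Literature.ModelTheory.ExponentialFields.isSemialgebraic_setOf_eval_le
        (k := ℚ) (R := ℝ) (0 : MvPolynomial (Fin 3) ℚ) (MvPolynomial.X (Fin.last 2))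
    have h3 : IsSemialgebraic ℚ {z : Fin 3 → ℝ | z (Fin.last 2) ≤ 1} := by
      simpa using Literature.ModelTheory.ExponentialFields.isSemialgebraic_setOf_eval_le
        (k := ℚ) (R := ℝ) (MvPolynomial.X (Fin.last 2)) (1 : MvPolynomial (Fin 3) ℚ)
    have e : E = {z : Fin 3 → ℝ | (Fin.init z : Fin 2 → ℝ) ∈ T.domain} ∩
        ({z : Fin 3 → ℝ | (0:ℝ) ≤ z (Fin.last 2)} ∩ {z : Fin 3 → ℝ | z (Fin.last 2) ≤ 1}) := by
      ext z; simp [hE]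
    rw [e]
    exact h1.inter (h2.inter h3)
  have hEsub : E ⊆ KZ.cube 3 := by
    intro z hz
    obtain ⟨hzP, hw0, hw1⟩ := hEmem.1 hz
    have h0 : 0 ≤ z 0 ∧ z 0 ≤ 1 := by simpa using KZ.mem_cube.1 hzP.1 0
    have h1 : 0 ≤ z 1 ∧ z 1 ≤ 1 := by simpa using KZ.mem_cube.1 hzP.1 1
    intro i
    fin_cases i
    · exact h0
    · exact h1
    · exact ⟨hw0, hw1⟩
  have hEclosed : IsClosed E := by
    have hPc : IsClosed P := by
      have h1 : IsClosed {y : Fin 2 → ℝ | y 1 ≤ y 0} :=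
        isClosed_le (continuous_apply 1) (continuous_apply 0)
      exact KZ.isClosed_cube.inter h1
    have e : E = (fun z : Fin 3 → ℝ => (Fin.init z : Fin 2 → ℝ)) ⁻¹' P ∩
        ((fun z : Fin 3 → ℝ => z (Fin.last 2)) ⁻¹' Set.Icc 0 1) := by
      ext z; simp [hE, hTd, hP]
    rw [e]
    refine (hPc.preimage ?_).inter (isClosed_Icc.preimage (continuous_apply _))
    exact continuous_pi fun i => continuous_apply _
  have hEcpt : IsCompact E := KZ.isCompact_cube.of_isClosed_subset hEclosed hEsub
  -- semialgebraic maps out of `E` and `P`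
  have hmapE01 : IsSemialgebraicMapOn ℚ E (fun z : Fin 3 → ℝ => (![z 0, z 1] : Fin 2 → ℝ)) :=
    IsSemialgebraicMapOn.of_forall hEs fun j => by
      fin_cases j
      · simpa using isSemialgebraicFunOn_apply hEs 0
      · simpa using isSemialgebraicFunOn_apply hEs 1
  have hmapE0 : IsSemialgebraicMapOn ℚ E (fun z : Fin 3 → ℝ => (fun _ : Fin 1 => z 0)) :=
    IsSemialgebraicMapOn.of_forall hEs fun _ => isSemialgebraicFunOn_apply hEs 0
  have hE01W : ∀ z ∈ E, (![z 0, z 1] : Fin 2 → ℝ) ∈ W := fun z hz => hPW (hEmem.1 hz).1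
  have hE0c : ∀ z ∈ E, (fun _ : Fin 1 => z 0) ∈ KZ.cube 1 := fun z hz _ => by
    simpa using KZ.mem_cube.1 (hEmem.1 hz).1.1 0
  have hcE : IsSemialgebraicFunOn ℚ E (fun z : Fin 3 → ℝ => c (z 0)) :=
    IsSemialgebraicFunOn.comp_isSemialgebraicMapOn_holds hcs hmapE0 hE0c
  have hQE : IsSemialgebraicFunOn ℚ E (fun z : Fin 3 → ℝ => Q ![z 0, z 1]) :=
    IsSemialgebraicFunOn.comp_isSemialgebraicMapOn_holds hQs hmapE01 hE01W
  have hQtE : IsSemialgebraicFunOn ℚ E (fun z : Fin 3 → ℝ => Qt ![z 0, z 1]) :=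
    IsSemialgebraicFunOn.comp_isSemialgebraicMapOn_holds hQts hmapE01 hE01W
  have hwE : IsSemialgebraicFunOn ℚ E (fun z : Fin 3 → ℝ => z 2) := isSemialgebraicFunOn_apply hEs 2
  -- the integrand `D` and the primitive `A` in the direction `w`
  obtain ⟨D, hD⟩ : ∃ D : (Fin 3 → ℝ) → ℝ, ∀ z, D z =
      c (z 0) * Qt ![z 0, z 1] / (1 - z 2 + z 2 * Q ![z 0, z 1]) ^ 2 := ⟨_, fun _ => rfl⟩
  obtain ⟨A, hA⟩ : ∃ A : (Fin 3 → ℝ) → ℝ, ∀ z, A z =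
      c (z 0) * z 2 * Qt ![z 0, z 1] / (1 - z 2 + z 2 * Q ![z 0, z 1]) := ⟨_, fun _ => rfl⟩
  have hDs : IsSemialgebraicFunOn ℚ E D := by
    rw [show D = _ from funext hD]
    exact (hcE.fun_mul hQtE).fun_mul
      ((((isSemialgebraicFunOn_const_natCast hEs 1).fun_sub hwE).fun_add (hwE.fun_mul hQE)).fun_pow 2).fun_inv
      |>.congr fun z _ => by simp [div_eq_mul_inv]
  have hAs : IsSemialgebraicFunOn ℚ E A := by
    rw [show A = _ from funext hA]
    exact ((hcE.fun_mul hwE).fun_mul hQtE).fun_mul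
      (((isSemialgebraicFunOn_const_natCast hEs 1).fun_sub hwE).fun_add (hwE.fun_mul hQE)).fun_inv
      |>.congr fun z _ => by simp [div_eq_mul_inv]
  -- continuity of `D` on `E` (for absolute integrability)
  have hc_cont : ∀ {s}, s ∈ Set.Icc (0:ℝ) 1 → ContinuousAt c s := fun hs => (hca _ hs).continuousAt
  have hDc : ContinuousOn D E := by
    intro z hz
    obtain ⟨hzP, hw0, hw1⟩ := hEmem.1 hz
    have hz0 : z 0 ∈ Set.Icc (0:ℝ) 1 := by simpa using KZ.mem_cube.1 hzP.1 0
    have hπ : ContinuousAt (fun z : Fin 3 → ℝ => (![z 0, z 1] : Fin 2 → ℝ)) z :=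
      continuousAt_pi.2 fun i => by fin_cases i <;> exact (continuous_apply _).continuousAt
    have h1 : ContinuousAt (fun z : Fin 3 → ℝ => c (z 0)) z :=
      (hc_cont hz0).comp_of_eq ((continuous_apply 0).continuousAt (x := z)) rfl
    have h2 : ContinuousAt (fun z : Fin 3 → ℝ => Qt ![z 0, z 1]) z :=
      (hQta _ (hPW hzP)).continuousAt.comp_of_eq hπ rfl
    have h3 : ContinuousAt (fun z : Fin 3 → ℝ => Q ![z 0, z 1]) z :=
      (hQa _ (hPW hzP)).continuousAt.comp_of_eq hπ rfl
    have h4 : ContinuousAt (fun z : Fin 3 → ℝ => (1 - z 2 + z 2 * Q ![z 0, z 1]) ^ 2) z :=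
      ((continuousAt_const.sub (continuous_apply 2).continuousAt).add
        ((continuous_apply 2).continuousAt.mul h3)).pow 2
    have hne : (1 - z 2 + z 2 * Q ![z 0, z 1]) ^ 2 ≠ 0 := pow_ne_zero 2 (hden hzP hw0 hw1).ne'
    rw [show D = _ from funext hD]
    exact ((h1.mul h2).div h4 hne).continuousWithinAt
  let RE : KZ.IntegralRep 3 :=
    { domain := E
      integrand := D
      isSemialgebraic_domain := hEs
      isSemialgebraicFunOn_integrand := hDs
      integrableOn := hDc.integrableOn_compact hEcpt }
  -- (2) Newton–Leibniz in `w`: `[E, D] − [P, A|₁ − A|₀] = [E, D] − [T]`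
  have hAw : ∀ y ∈ P, ∀ w ∈ Set.Icc (0:ℝ) 1,
      HasDerivAt (fun v : ℝ => A (Fin.snoc y v)) (D (Fin.snoc y w)) w := by
    intro y hy w hw
    have hy01 : (![y 0, y 1] : Fin 2 → ℝ) = y := (hvec2 y).symm
    simp only [hA, hD, snoc_eq, Matrix.cons_val_zero, Matrix.cons_val_one, Matrix.head_cons,
      Matrix.cons_val_two, Matrix.tail_cons, hy01]
    set k : ℝ := c (y 0) * Qt y with hk
    set q : ℝ := Q y with hq
    have hdenw : 1 - w + w * q ≠ 0 := (hden hy hw.1 hw.2).ne'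
    have hnum : HasDerivAt (fun v : ℝ => k * v) k w := by
      simpa using (hasDerivAt_id w).const_mul k
    have hdn : HasDerivAt (fun v : ℝ => 1 - v + v * q) (q - 1) w := by
      have h0 := ((hasDerivAt_id' w).const_mul (q - 1)).const_add 1
      have e : (fun v : ℝ => 1 - v + v * q) = fun x => 1 + (q - 1) * x := by funext v; ring
      rw [e]
      simpa using h0
    have h := hnum.div hdn hdenw
    have e1 : (fun v : ℝ => c (y 0) * v * Qt y / (1 - v + v * q)) = fun v => k * v / (1 - v + v * q) := by
      funext v; rw [hk]; ring
    rw [e1]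
    refine h.congr_deriv ?_
    rw [hk]
    field_simp
    ring
  have hAc : ∀ y ∈ P, ContinuousOn (fun v : ℝ => A (Fin.snoc y v)) (Set.Icc 0 1) :=
    fun y hy v hv => (hAw y hy v hv).continuousAt.continuousWithinAt
  have hNL1 : KZ.of RE - KZ.of T ∈ KZ.relations := by
    refine KZ.newtonLeibnizRel_subset_relations
      ⟨2, RE, T, fun _ => 0, fun _ => 1, A, hAs, ?_, ?_, fun _ _ => zero_le_one, rfl, ?_, ?_, ?_, rfl⟩
    · rw [hTd]; simpa using isSemialgebraicFunOn_const_natCast hPs 0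
    · rw [hTd]; simpa using isSemialgebraicFunOn_const_natCast hPs 1
    · intro y hy; rw [hTd] at hy; exact hAc y hy
    · intro y hy w hw; rw [hTd] at hy
      exact hAw y hy w ⟨hw.1.le, hw.2.le⟩
    · intro y hy
      rw [hTd] at hy
      rw [hTi y hy, hA, hA]
      have hy01 : (![y 0, y 1] : Fin 2 → ℝ) = y := (hvec2 y).symm
      simp only [snoc_eq, Matrix.cons_val_zero, Matrix.cons_val_one, Matrix.head_cons,
        Matrix.cons_val_two, Matrix.tail_cons, hy01, hQt]
      ring
  -- (3) the swap `t ↔ w` and Newton–Leibniz in `t` over the base `[0,1]² ∋ (s, w)`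
  set RE' := RE.reindex (Equiv.swap (1 : Fin 3) 2) with hRE'
  have hre : KZ.of RE - KZ.of RE' ∈ KZ.relations := KZ.of_sub_of_reindex_mem_relations RE _
  have hRE'd : RE'.domain = {z : Fin 3 → ℝ | (Fin.init z : Fin 2 → ℝ) ∈ KZ.cube 2 ∧
      (0:ℝ) ≤ z (Fin.last 2) ∧ z (Fin.last 2) ≤ (Fin.init z : Fin 2 → ℝ) 0} := by
    ext z
    rw [hRE', KZ.IntegralRep.reindex_domain, mem_setOf_eq]
    change (fun i => z (Equiv.swap (1 : Fin 3) 2 i)) ∈ E ↔ _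
    rw [hEmem]
    simp only [hsw, Equiv.swap_apply_left, Equiv.swap_apply_right, mem_setOf_eq, init_fin_three, hP,
      KZ.mem_cube, Fin.forall_fin_two, Matrix.cons_val_zero, Matrix.cons_val_one,
      show (Fin.last 2 : Fin 3) = 2 from rfl]
    constructor
    · rintro ⟨⟨⟨h0, h2⟩, h20⟩, h1⟩
      exact ⟨⟨h0, h1⟩, h2.1, h20⟩
    · rintro ⟨⟨h0, h1⟩, h20, h2⟩
      exact ⟨⟨⟨h0, h20, h2.trans h0.2⟩, h2⟩, h1⟩
  have hRE'i : ∀ z, RE'.integrand z = D (fun i => z (Equiv.swap (1 : Fin 3) 2 i)) := fun z => rfl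
  -- the primitive `B' (s, w, t) = c(s) (Q(s,t) − 1) / (1 − w + w Q(s,t))`
  obtain ⟨B, hB⟩ : ∃ B : (Fin 3 → ℝ) → ℝ, ∀ z, B z =
      c (z 0) * (Q ![z 0, z 2] - 1) / (1 - z 1 + z 1 * Q ![z 0, z 2]) := ⟨_, fun _ => rfl⟩
  have hE's : IsSemialgebraic ℚ RE'.domain := RE'.isSemialgebraic_domain
  have hmem' : ∀ {z : Fin 3 → ℝ}, z ∈ RE'.domain → (![z 0, z 2] : Fin 2 → ℝ) ∈ P ∧ 0 ≤ z 1 ∧ z 1 ≤ 1 := by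
    intro z hz
    rw [hRE'd] at hz
    obtain ⟨hc2, h20, h2⟩ := hz
    rw [init_fin_three] at hc2 h2
    have h0 : 0 ≤ z 0 ∧ z 0 ≤ 1 := by simpa using KZ.mem_cube.1 hc2 0
    have h1 : 0 ≤ z 1 ∧ z 1 ≤ 1 := by simpa using KZ.mem_cube.1 hc2 1
    exact ⟨hPmem h20 (by simpa using h2) h0.2, h1.1, h1.2⟩
  have hBs : IsSemialgebraicFunOn ℚ RE'.domain B := by
    have hmap02 : IsSemialgebraicMapOn ℚ RE'.domain (fun z : Fin 3 → ℝ => (![z 0, z 2] : Fin 2 → ℝ)) :=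
      IsSemialgebraicMapOn.of_forall hE's fun j => by
        fin_cases j
        · simpa using isSemialgebraicFunOn_apply hE's 0
        · simpa using isSemialgebraicFunOn_apply hE's 2
    have hmap0 : IsSemialgebraicMapOn ℚ RE'.domain (fun z : Fin 3 → ℝ => (fun _ : Fin 1 => z 0)) :=
      IsSemialgebraicMapOn.of_forall hE's fun _ => isSemialgebraicFunOn_apply hE's 0
    have hc' : IsSemialgebraicFunOn ℚ RE'.domain (fun z : Fin 3 → ℝ => c (z 0)) :=
      IsSemialgebraicFunOn.comp_isSemialgebraicMapOn_holds hcs hmap0 fun z hz _ => by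
        simpa using KZ.mem_cube.1 (hmem' hz).1.1 0
    have hQ' : IsSemialgebraicFunOn ℚ RE'.domain (fun z : Fin 3 → ℝ => Q ![z 0, z 2]) :=
      IsSemialgebraicFunOn.comp_isSemialgebraicMapOn_holds hQs hmap02 fun z hz => hPW (hmem' hz).1
    have hw' : IsSemialgebraicFunOn ℚ RE'.domain (fun z : Fin 3 → ℝ => z 1) := isSemialgebraicFunOn_apply hE's 1
    rw [show B = _ from funext hB]
    exact (hc'.fun_mul (hQ'.fun_sub (isSemialgebraicFunOn_const_natCast hE's 1))).fun_mul
      (((isSemialgebraicFunOn_const_natCast hE's 1).fun_sub hw').fun_add (hw'.fun_mul hQ')).fun_inv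
      |>.congr fun z _ => by simp [div_eq_mul_inv]
  -- the derivative of `t ↦ B'(s, w, t)` is `D(s, t, w)`
  have hBt : ∀ x ∈ KZ.cube 2, ∀ t, 0 ≤ t → t ≤ x 0 →
      HasDerivAt (fun v : ℝ => B (Fin.snoc x v)) (RE'.integrand (Fin.snoc x t)) t := by
    intro x hx t ht0 htx
    have hx0 : 0 ≤ x 0 ∧ x 0 ≤ 1 := KZ.mem_cube.1 hx 0
    have hx1 : 0 ≤ x 1 ∧ x 1 ≤ 1 := KZ.mem_cube.1 hx 1
    have hmemP : (![x 0, t] : Fin 2 → ℝ) ∈ P := hPmem ht0 htx hx0.2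
    rw [hRE'i]
    simp only [hB, hD, snoc_eq, Matrix.cons_val_zero, Matrix.cons_val_one, Matrix.head_cons,
      Matrix.cons_val_two, Matrix.tail_cons, Equiv.swap_apply_left, Equiv.swap_apply_right, hsw]
    set w : ℝ := x 1 with hw
    have hQd := hQder (x 0) t (hPW hmemP)
    have hdenv : ∀ v, 0 ≤ v → v ≤ x 0 → 1 - w + w * Q ![x 0, v] ≠ 0 := fun v hv0 hv =>
      (hden (hPmem hv0 hv hx0.2) hx1.1 hx1.2).ne'
    have hnum : HasDerivAt (fun v : ℝ => c (x 0) * (Q ![x 0, v] - 1)) (c (x 0) * Qt ![x 0, t]) t := by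
      simpa using (hQd.sub_const 1).const_mul (c (x 0))
    have hdn : HasDerivAt (fun v : ℝ => 1 - w + w * Q ![x 0, v]) (w * Qt ![x 0, t]) t := by
      simpa using (hQd.const_mul w).const_add (1 - w)
    have h := hnum.div hdn (hdenv t ht0 htx)
    refine h.congr_deriv ?_
    field_simp
    ring
  have hBc : ∀ x ∈ KZ.cube 2, ContinuousOn (fun v : ℝ => B (Fin.snoc x v)) (Set.Icc 0 (x 0)) :=
    fun x hx v hv => (hBt x hx v hv.1 hv.2).continuousAt.continuousWithinAt
  obtain ⟨Z2, hZ2d, hZ2i⟩ := KZ.exists_zeroRep (KZ.isSemialgebraic_cube (n := 2))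
  have hNL2 : KZ.of RE' - KZ.of Z2 ∈ KZ.relations := by
    refine KZ.newtonLeibnizRel_subset_relations
      ⟨2, RE', Z2, fun _ => 0, fun x => x 0, B, hBs, ?_, ?_, ?_, ?_, ?_, ?_, ?_, rfl⟩
    · rw [hZ2d]; simpa using isSemialgebraicFunOn_const_natCast (KZ.isSemialgebraic_cube (n := 2)) 0
    · rw [hZ2d]; exact isSemialgebraicFunOn_apply KZ.isSemialgebraic_cube 0
    · intro x hx; rw [hZ2d] at hx; exact (KZ.mem_cube.1 hx 0).1
    · rw [hRE'd, hZ2d]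
    · intro x hx; rw [hZ2d] at hx; exact hBc x hx
    · intro x hx t ht; rw [hZ2d] at hx
      exact hBt x hx t ht.1.le ht.2.le
    · intro x hx
      rw [hZ2d] at hx
      have hx0 : 0 ≤ x 0 ∧ x 0 ≤ 1 := KZ.mem_cube.1 hx 0
      rw [hZ2i]
      simp only [hB, snoc_eq, Matrix.cons_val_zero, Matrix.cons_val_one, Matrix.head_cons,
        Matrix.cons_val_two, Matrix.tail_cons, hQ0 (x 0) hx0, hQ1 (x 0) hx0, sub_self, mul_zero,
        zero_div, Pi.zero_apply]
  have hZ2 : KZ.of Z2 ∈ KZ.relations :=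
    KZ.of_mem_relations_of_eqOn_zero Z2 fun x _ => by rw [hZ2i]
  -- (4) assembly
  have e : KZ.of T = -(KZ.of RE - KZ.of T) + (KZ.of RE - KZ.of RE') + (KZ.of RE' - KZ.of Z2) + KZ.of Z2 := by
    abel
  rw [e]
  exact KZ.relations.add_mem (KZ.relations.add_mem (KZ.relations.add_mem
    (KZ.relations.neg_mem hNL1) hre) hNL2) hZ2

/-- **A closed-loop logarithmic derivative on the triangle band is a relation** (closed form of
`triangle_closedLoop_dlog_mem_relations`, quantifiers in front; registered statement).
[cite: KontsevichZagier2001, §1.2 rules (2), (3)] [cite: Ayoub2015, Rem. 1.5] -/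
theorem triangle_closedLoop_dlog_mem_relations_closed :
    ∀ (c : ℝ → ℝ) (W : Set (Fin 2 → ℝ)) (Q : (Fin 2 → ℝ) → ℝ), (∀ s ∈ Set.Icc (0:ℝ) 1, AnalyticAt ℝ c s) → Literature.NumberTheory.Transcendental.IsSemialgebraicFunOn ℚ (Literature.NumberTheory.Transcendental.KZ.cube 1) (fun x : Fin 1 → ℝ => c (x 0)) → IsOpen W → {y : Fin 2 → ℝ | y ∈ Literature.NumberTheory.Transcendental.KZ.cube 2 ∧ y 1 ≤ y 0} ⊆ W → Literature.NumberTheory.Transcendental.IsSemialgebraicFunOn ℚ W Q → AnalyticOnNhd ℝ Q W → (∀ y ∈ {y : Fin 2 → ℝ | y ∈ Literature.NumberTheory.Transcendental.KZ.cube 2 ∧ y 1 ≤ y 0}, 0 < Q y) → (∀ s ∈ Set.Icc (0:ℝ) 1, Q ![s, 0] = 1) → (∀ s ∈ Set.Icc (0:ℝ) 1, Q ![s, s] = 1) → ∀ (T : Literature.NumberTheory.Transcendental.KZ.IntegralRep 2), T.domain = {y : Fin 2 → ℝ | y ∈ Literature.NumberTheory.Transcendental.KZ.cube 2 ∧ y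 1 ≤ y 0} → (∀ y ∈ {y : Fin 2 → ℝ | y ∈ Literature.NumberTheory.Transcendental.KZ.cube 2 ∧ y 1 ≤ y 0}, T.integrand y = c (y 0) * fderiv ℝ Q y (Pi.single 1 1) / Q y) → Literature.NumberTheory.Transcendental.KZ.of T ∈ Literature.NumberTheory.Transcendental.KZ.relations := by
  intro c W Q hca hcs hWo hPW hQs hQa hQpos hQ0 hQ1 T hTd hTi
  exact triangle_closedLoop_dlog_mem_relations hca hcs hWo hPW hQs hQa hQpos hQ0 hQ1 T hTd hTi

end Summit.KontsevichZagierPeriods.LiftingCriteria.DilationTransfer
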